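import Summits.HodgeConjecture.HodgeConjecture.Theorems.MarkmanPartnerTransportPicardThreeK3SquaresKugaSatakePairSimilitude
import Literature.AlgebraicGeometry.Surfaces.K3TranscendentalHodgeSimilitudesKugaSatake
import Literature.AlgebraicGeometry.Surfaces.K3MarkingProofs
import Literature.AlgebraicGeometry.Surfaces.K3TwoZeroLine
import Literature.AlgebraicGeometry.HodgeTheory.HypersurfaceHolomorphicFormsProofs
import Literature.AlgebraicGeometry.Motives.HodgeStructureK3TranscendentalProjector

/-!
# Route MarkmanPartnerTransport · crux `PicardThreeK3Squares` (stmt-HodgeConjecture-19652) —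
# VARESCO'S THEOREM 5.3 IN THE KERNEL: the named fact
# `Surfaces.Varesco2023_transcendentalHodgeSimilitude_algebraic_of_kugaSatake_K3` HOLDS

Programme «KS-PAIR» (gen 15), endpoint. The Literature record
`Surfaces.Varesco2023_transcendentalHodgeSimilitude_algebraic_of_kugaSatake_K3` (M. Varesco, Math. Z. 305
(2023), Thm. 5.3 = Cor. 4.6 for K3 surfaces: "Let `S` and `S'` be K3 surfaces for which the Kuga–Satake
Hodge conjecture holds. Then, every Hodge similarity between `T(S)` and `T(S')` is algebraic") was so far
an UNPROVED `def … : Prop`, consumed as a hypothesis `hVar` on the Kuga–Satake branches of the crux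
(`…KugaSatakeSimilitude`, `…SimilitudeInvariance`-type statements) and cited by route
NikulinTwinTransport. This file proves it: `Varesco2023_transcendentalHodgeSimilitude_algebraic_of_kugaSatake_K3_holds`.

The antecedents of the record (the Kuga–Satake predicates of `S` and `S'`) are untouched — what is
removed is the printed THEOREM between them and the conclusion, whose published proof (Lemma 4.4) uses a
deformation to a Mumford–Tate general point; the tree's proof (`…KugaSatakePairSimilitude`) replaces it by
the subfield trick in `End_Hdg T(S')`. The wrapper supplies, fact-free:

* `exists_traceC_cupProduct_eq_of_isFujikiForm` — a Fujiki form with `n = 1` is the intersection form up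
  to `ℂˣ`: `∫_S x ∪ y = κ · b(x, y)`, `κ ≠ 0` (polarisation of `a ∪ a = c·b(a,a)·P`);
* `exists_rational_transcendentalProjector` — a RATIONAL, type-preserving projector `Q` of `H²(S(ℂ); ℂ)`
  onto `T(S)_ℂ` (complexification of the Kahn–Murre–Pedrini / Huybrechts projector of the polarizable
  K3-type structure `H²_B(S)`), used to extend `ψ|_{T(S)}` to all of `H²` without changing it on `T(S)`;
* the `(2,0)`-lines of K3 surfaces (`IsK3Surface.exists_isOfHodgeType_twoZero_ne_zero` with
  `Voisin2002_closedForm_top_zero_not_exact_holds`, `IsK3Surface.twoZero_line`);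
* `varesco2023_transcendentalHodgeSimilitude_algebraic_of_kugaSatake_K3_holds` — **THE NAMED FACT**.

CONDITIONAL on nothing beyond the record's own antecedents (the two Kuga–Satake predicates are
HYPOTHESES inside the statement, open in print for general K3 surfaces); no definition, no new named
fact, no sorry; nothing here says HC or the crux is proved. Prover seat hodge-nonav-19652-p1 (gen 15),
`--supports stmt-HodgeConjecture-19652`; ledger fact claim #1 on the record.

References: M. Varesco, *Hodge similarities, algebraic classes, and Kuga–Satake varieties*, Math. Z. 305
(2023), Thm. 5.3, Cor. 4.6, Thm. 4.5, Lemma 4.4, §0.3; D. Huybrechts, *Lectures on K3 Surfaces*, Ch. 1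
(2.7), Ch. 3 Lemma 3.1; B. Kahn, J. Murre, C. Pedrini (2007), Prop. 7.2.3; C. Voisin, *Hodge Theory I*,
Cor. 7.6, §7.1.
-/

set_option linter.dupNamespace false

noncomputable section

namespace Summit.HodgeConjecture.HodgeConjecture.Theorems.MarkmanPartnerTransport.KugaSatakePair

open scoped TensorProduct
open CategoryTheory MonoidalCategory Literature.AlgebraicGeometry Literature.AlgebraicGeometry.Motives
open Literature.AlgebraicGeometry.HodgeTheory Literature.AlgebraicTopology.SingularHomology
open Literature.AlgebraicGeometry.Motives.HodgeStructure
open Literature.AlgebraicGeometry.Surfaces Literature.AlgebraicGeometry.Hyperkaehler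
open Summit.HodgeConjecture.HodgeConjecture.Theorems.OddPrimeSquares
open Summit.HodgeConjecture.HodgeConjecture.Theorems.MarkmanPartnerTransport.TranscendentalPresentation
open Summit.HodgeConjecture.HodgeConjecture.Theorems.MarkmanPartnerTransport.KugaSatakeSelf

variable {S S' : SchemeOver ℂ}

/-- `H²_B(S)`: the weight-two `ℚ`-Hodge structure on `H²(S(ℂ); ℚ)` of the real Hodge model of `S`. -/
local notation3 "H²[" hS "]" =>
  bettiTwoHodgeStructure hS (BettiUniverse.realHodgeModel exists_isReal_hodgeModel_holds hS)
    (BettiUniverse.realHodgeModel_isHodgeSymmetric exists_isReal_hodgeModel_holds hS)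

/-- `T(S)_ℚ = Hdg¹^⊥ ⊆ H²(S(ℂ); ℚ)`. -/
local notation3 "T[" hS "]" =>
  transcendentalLatticeBetti hS (BettiUniverse.realHodgeModel exists_isReal_hodgeModel_holds hS)
    (BettiUniverse.realHodgeModel_isHodgeSymmetric exists_isReal_hodgeModel_holds hS)

/-- `Θ : ℂ ⊗_ℚ H²(S(ℂ); ℚ) → H²(S(ℂ); ℂ)`. -/
local notation3 "Θ[" S "]" => ofRatClassBaseChange (Motives.ComplexPoints S) (2 * 1)

/-- `ι : H²(S(ℂ); ℚ) → H²(S(ℂ); ℂ)`, the rational lattice. -/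
local notation3 "ι[" S "]" => ofRatClass (Motives.ComplexPoints S) (2 * 1)

/-- `Transc[S, y]`: `y` is cup-orthogonal to `N¹(S) = algebraicClasses S 1`. Local notation only. -/
local notation3 (prettyPrint := false) "Transc[" S ", " y "]" =>
  (∀ d ∈ algebraicClasses S 1, cupProduct (rfl : 2 * 1 + 2 * 1 = 2 * 2) y d = 0)

/-! ### §1 A Fujiki form with `n = 1` is the intersection form up to a unit -/

/-- **For a surface, a Fujiki form `b` with `n = 1` satisfies `∫_S x ∪ y = κ · b(x, y)` with `κ ≠ 0`**:
polarisation of Fujiki's relation `a ∪ a = (c · b(a,a)) · P` (graded commutativity in degree `2`) gives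
`x ∪ y = (c · b(x,y)) · P`, and `κ = c · ∫ P ≠ 0` (`P ≠ 0`, the trace is injective on `H⁴`).
[cite: Huybrechts1999, §1.11 (Fujiki relation, n = 1)] [cite: HatcherAT2002, §3.3 Thm. 3.26] -/
theorem exists_traceC_cupProduct_eq_of_isFujikiForm (hX : IsSmoothProjective 2 S)
    {b : complexBetti S 2 →ₗ[ℂ] complexBetti S 2 →ₗ[ℂ] ℂ} (hb : IsFujikiForm 1 S b) :
    ∃ κ : ℂ, κ ≠ 0 ∧ ∀ x y : complexBetti S (2 * 1),
      traceC hX (cupProduct (rfl : 2 * 1 + 2 * 1 = 2 * 2) x y) = κ * b x y := by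
  obtain ⟨hsymm, c, P, hc, hP, hrel⟩ := hb
  have hsq : ∀ a : complexBetti S 2, cupProduct (rfl : 2 * 1 + 2 * 1 = 2 * 2) a a = (c * b a a) • P := by
    intro a
    have h1 := hrel a
    change cupPowTwo a 2 = _ at h1
    rw [cupPowTwo_two, pow_one] at h1
    exact h1
  have hcomm : ∀ u v : complexBetti S 2,
      cupProduct (rfl : 2 * 1 + 2 * 1 = 2 * 2) v u = cupProduct (rfl : 2 * 1 + 2 * 1 = 2 * 2) u v := by
    intro u v
    rw [cupProduct_gradedComm_holds ℂ (Motives.ComplexPoints S) (rfl : 2 * 1 + 2 * 1 = 2 * 2)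
      (rfl : 2 * 1 + 2 * 1 = 2 * 2) v u]
    norm_num
  have key : ∀ u v : complexBetti S 2, cupProduct (rfl : 2 * 1 + 2 * 1 = 2 * 2) u v = (c * b u v) • P := by
    intro u v
    have e1 : cupProduct (rfl : 2 * 1 + 2 * 1 = 2 * 2) (u + v) (u + v) =
        cupProduct (rfl : 2 * 1 + 2 * 1 = 2 * 2) u u + (2 : ℂ) • cupProduct (rfl : 2 * 1 + 2 * 1 = 2 * 2) u v +
          cupProduct (rfl : 2 * 1 + 2 * 1 = 2 * 2) v v := by
      rw [LinearMap.map_add₂, map_add, map_add, hcomm u v, two_smul]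
      abel
    have e2 : b (u + v) (u + v) = b u u + 2 * b u v + b v v := by
      rw [LinearMap.map_add₂, map_add, map_add, hsymm v u]
      ring
    have e3 : (2 : ℂ) • cupProduct (rfl : 2 * 1 + 2 * 1 = 2 * 2) u v = (2 * (c * b u v)) • P := by
      have h := hsq (u + v)
      rw [e1, hsq u, hsq v, e2] at h
      have h' : (2 : ℂ) • cupProduct (rfl : 2 * 1 + 2 * 1 = 2 * 2) u v =
          (c * (b u u + 2 * b u v + b v v)) • P - (c * b u u) • P - (c * b v v) • P := by
        rw [← h]; abel
      rw [h', ← sub_smul, ← sub_smul]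
      congr 1
      ring
    have h2 : (2 : ℂ) ≠ 0 := two_ne_zero
    calc cupProduct (rfl : 2 * 1 + 2 * 1 = 2 * 2) u v
        = (2 : ℂ)⁻¹ • ((2 : ℂ) • cupProduct (rfl : 2 * 1 + 2 * 1 = 2 * 2) u v) := by
          rw [smul_smul, inv_mul_cancel₀ h2, one_smul]
      _ = (2 : ℂ)⁻¹ • ((2 * (c * b u v)) • P) := by rw [e3]
      _ = (c * b u v) • P := by
          rw [smul_smul]
          congr 1
          field_simp
  have hτ : traceC hX P ≠ 0 := fun h0 => hP (eq_zero_of_traceC_eq_zero hX h0)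
  refine ⟨c * traceC hX P, mul_ne_zero hc hτ, fun x y => ?_⟩
  rw [key x y, map_smul, smul_eq_mul]
  ring

/-! ### §2 A rational type-preserving projector onto `T(S)_ℂ` -/

/-- Membership in a Hodge piece of `H²_B(S)` read on `H²(S(ℂ); ℂ)` through `Θ`.
[cite: VoisinHodgeI2002, §7.1.1] -/
theorem mem_piece_iff_isOfHodgeType (hX : IsSmoothProjective 2 S) {p q : ℕ} (hpq : p + q = 2)
    (x : ℂ ⊗[ℚ] bettiCohomology S (2 * 1)) :
    x ∈ (H²[hX]).piece p q ↔ IsOfHodgeType 2 S (2 * 1) p q (Θ[S] x) := by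
  have h := BettiUniverse.mem_hodge_piece_iff exists_isReal_hodgeModel_holds
    hodgePQ_independent_of_hodgeModel_holds hX (k := 2 * 1) (p := p) (q := q) (by omega) x
  rw [bettiTwoHodgeStructure, cast_piece]
  exact_mod_cast h

/-- **A rational, type-preserving projector of `H²(S(ℂ); ℂ)` onto `T(S)_ℂ`.** For a smooth projective
surface `S` with `h^{2,0} = 1` there is a `ℂ`-linear `Q` on `H²(S(ℂ); ℂ)` mapping rational classes to
rational classes and classes of type `(i, j)` to classes of type `(i, j)`, with `Q y ⊥ N¹(S)` for all `y`
and `Q y = y` whenever `y ⊥ N¹(S)`: the complexification of the transcendental projector `p ∈ End_Hdg(H²_B(S))`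
(`p|_T = id`, `p|_{Hdg¹} = 0`, `im p = T`) of the polarizable K3-type structure `H²_B(S) = Hdg¹ ⊕ T(S)_ℚ`.
[cite: KahnMurrePedrini2007, §7.2 Prop. 7.2.3] [cite: Huybrechts2016K3, Ch. 3 Lemma 3.1] -/
theorem exists_rational_transcendentalProjector (hX : IsSmoothProjective 2 S) {σ : complexBetti S (2 * 1)}
    (hσ : IsOfHodgeType 2 S (2 * 1) 2 0 σ) (hσ0 : σ ≠ 0)
    (hline : ∀ c : complexBetti S (2 * 1), IsOfHodgeType 2 S (2 * 1) 2 0 c → ∃ t : ℂ, c = t • σ) :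
    ∃ Q : complexBetti S (2 * 1) →ₗ[ℂ] complexBetti S (2 * 1),
      (∀ y, IsRationalClass y → IsRationalClass (Q y)) ∧
      (∀ (i j : ℕ) y, IsOfHodgeType 2 S (2 * 1) i j y → IsOfHodgeType 2 S (2 * 1) i j (Q y)) ∧
      (∀ y, Transc[S, Q y]) ∧ (∀ y, Transc[S, y] → Q y = y) := by
  classical
  haveI : Module.Finite ℚ (bettiCohomology S (2 * 1)) := BettiUniverse.finite hX (2 * 1)
  have hK3 := isOfK3Type_bettiTwo hX hσ hσ0 hline
  have hpol := isPolarizable_bettiTwo hX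
  obtain ⟨T, hT, htr⟩ := exists_isTranscendentalPart_orthogonal_hodgeClasses hK3 (cupPairingBetti hX)
    (cupPairingBetti_isSymm hX) (cupPairingBetti_nondegenerate hX) (hodge_F_apply_eq_zero hX)
    (cupPairingBetti_twoZero_conj_ne_zero hX)
  have hT' : T.toSubmodule = T[hX] := hT
  obtain ⟨p, hp1, hp0⟩ := IsTranscendentalPart.exists_transcendentalProjector hK3 hpol htr
  have hrange := IsTranscendentalPart.range_transcendentalProjector hK3 hpol htr hp1 hp0
  -- `p` factors through `T`
  have hmemT : ∀ v, (p : Module.End ℚ (bettiCohomology S (2 * 1))) v ∈ T.toSubmodule :=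
    fun v => hrange ▸ LinearMap.mem_range_self _ v
  set p' : bettiCohomology S (2 * 1) →ₗ[ℚ] T.toSubmodule :=
    LinearMap.codRestrict T.toSubmodule (p : Module.End ℚ (bettiCohomology S (2 * 1))) hmemT with hp'
  have hpp' : (p : Module.End ℚ (bettiCohomology S (2 * 1))) = T.toSubmodule.subtype ∘ₗ p' := by
    ext v; rfl
  -- `Θ` as an equivalence
  let Θe : (ℂ ⊗[ℚ] bettiCohomology S (2 * 1)) ≃ₗ[ℂ] complexBetti S (2 * 1) :=
    LinearEquiv.ofBijective (Θ[S]) ⟨ofRatClassBaseChange_injective _ _, ofRatClassBaseChange_surjective hX (2 * 1)⟩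
  have hΘe : ∀ x, Θe x = Θ[S] x := fun _ => rfl
  have hΘe_symm : ∀ w : bettiCohomology S (2 * 1), Θe.symm (ι[S] w) = (1 : ℂ) ⊗ₜ[ℚ] w := by
    intro w
    apply Θe.injective
    rw [LinearEquiv.apply_symm_apply, hΘe, ofRatClassBaseChange_tmul, one_smul]
  set Q : complexBetti S (2 * 1) →ₗ[ℂ] complexBetti S (2 * 1) :=
    Θe.toLinearMap ∘ₗ (p : Module.End ℚ (bettiCohomology S (2 * 1))).baseChange ℂ ∘ₗ Θe.symm.toLinearMap with hQ
  have hQapply : ∀ y, Q y = Θ[S] ((p : Module.End ℚ (bettiCohomology S (2 * 1))).baseChange ℂ (Θe.symm y)) :=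
    fun y => rfl
  refine ⟨Q, fun y hy => ?_, fun i j y hy => ?_, fun y => ?_, fun y hy => ?_⟩
  · -- rational
    obtain ⟨w, rfl⟩ := (isRationalClass_iff_mem_range_ofRatClass y).1 hy
    rw [hQapply, hΘe_symm, LinearMap.baseChange_tmul, ofRatClassBaseChange_tmul, one_smul]
    exact isRationalClass_ofRatClass _
  · -- type-preserving
    by_cases hij : i + j = 2
    · have hx : Θe.symm y ∈ (H²[hX]).piece i j := by
        rw [mem_piece_iff_isOfHodgeType hX hij]
        change IsOfHodgeType 2 S (2 * 1) i j (Θe (Θe.symm y))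
        rwa [LinearEquiv.apply_symm_apply]
      rw [hQapply, ← mem_piece_iff_isOfHodgeType hX hij]
      exact endAlg.baseChange_mem_piece p hx
    · -- off the antidiagonal the piece is `⊥`, so `y = 0` (cf. `NikulinTwinTransport.isOfHodgeType_eq_zero_of_add_ne`)
      have hij' : i + j ≠ 2 * 1 := by omega
      have hy0 : y = 0 := by
        obtain ⟨A, hA⟩ := hy
        rw [(A.hodgePQ_eq_bot_iff (2 * 1) i j).2 (Literature.NumberTheory.Transcendental.hodgePQ_eq_bot_of_ne hij'),
          Submodule.mem_bot] at hA
        exact A.pullback_injective (2 * 1) (by rw [hA, map_zero])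
      rw [hy0, map_zero]
      exact IsOfHodgeType.zero (BettiUniverse.realHodgeModel exists_isReal_hodgeModel_holds hX) _ _ _
  · -- image in `T(S)_ℂ`
    rw [hQapply, hpp', LinearMap.baseChange_comp, LinearMap.comp_apply]
    exact transc_of_baseChange hX T hT' _
  · -- identity on `T(S)_ℂ`
    obtain ⟨x, rfl⟩ := exists_baseChange_eq_of_transc hX T hT' hy
    have hsymm : Θe.symm (Θ[S] (T.toSubmodule.subtype.baseChange ℂ x)) = T.toSubmodule.subtype.baseChange ℂ x := by
      apply Θe.injective
      rw [LinearEquiv.apply_symm_apply, hΘe]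
    have h : ∀ x : ℂ ⊗[ℚ] T.toSubmodule, (p : Module.End ℚ (bettiCohomology S (2 * 1))).baseChange ℂ
        (T.toSubmodule.subtype.baseChange ℂ x) = T.toSubmodule.subtype.baseChange ℂ x := by
      intro x
      induction x using TensorProduct.induction_on with
      | zero => simp only [map_zero]
      | tmul c t => rw [LinearMap.baseChange_tmul, LinearMap.baseChange_tmul, Submodule.subtype_apply, hp1 _ t.2]
      | add x y hx hy => simp only [map_add, hx, hy]
    rw [hQapply, hsymm, h]

/-! ### §3 The named fact -/

/-- **VARESCO 2023, THEOREM 5.3, PROVED: for two projective K3 surfaces whose Kuga–Satake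
correspondences are algebraic, every rational Hodge similitude of their transcendental lattices is
induced by an algebraic cycle** — the tree's named fact
`Surfaces.Varesco2023_transcendentalHodgeSimilitude_algebraic_of_kugaSatake_K3`, verbatim. Proof: the
`(2,0)`-lines of `S`, `S'` (K3), the rational transcendental projector `Q` of `S` (WLOG `ψ` is defined
and rational on all of `H²(S)`, `ψ ∘ Q = ψ` on `T(S)`), Fujiki forms with `n = 1` are `∫ (· ∪ ·)` up to
units (so "`b'(ψx, ψy) = b(x, y)`" is a constant multiplier on `T(S)_ℂ`), and the two-surface theorem
`exists_algebraicCorrespondence_eq_of_similitude_of_kugaSatake₂` (two presentations on one Kuga–Satake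
variety, Lefschetz–transpose, Hodge–Riemann, rational descent, Zarhin's field, subfield trick).
CONDITIONAL only inside the statement (its Kuga–Satake antecedents); no named fact is assumed.
[cite: Varesco2023, Thm. 5.3 (§5), Cor. 4.6, Thm. 4.5 and §0.3] [cite: Floccari2026, §3.3 Rem. 3.4]
[cite: Huybrechts2016K3, Ch. 1 (2.7) and Ch. 3 Lemma 3.1] -/
theorem varesco2023_transcendentalHodgeSimilitude_algebraic_of_kugaSatake_K3_holds :
    Varesco2023_transcendentalHodgeSimilitude_algebraic_of_kugaSatake_K3 := by
  intro S S' hS hS' hKS hKS' b b' hb hb' ψ hψrat hψbij hψH hψiso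
  classical
  have hX := hS.isSmoothProjective
  have hX' := hS'.isSmoothProjective
  -- the `(2,0)`-lines
  obtain ⟨σ, hσ0, hσ⟩ := hS.exists_isOfHodgeType_twoZero_ne_zero
    (fun E _ _ _ M _ _ ↦ HodgeTheory.Voisin2002_closedForm_top_zero_not_exact_holds E M)
  obtain ⟨σ', hσ'0, hσ'⟩ := hS'.exists_isOfHodgeType_twoZero_ne_zero
    (fun E _ _ _ M _ _ ↦ HodgeTheory.Voisin2002_closedForm_top_zero_not_exact_holds E M)
  have hline := hS.twoZero_line hσ hσ0
  have hline' := hS'.twoZero_line hσ' hσ'0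
  -- `transcendentalPart = {Transc}`
  have hmem : ∀ y : complexBetti S (2 * 1), y ∈ transcendentalPart S b ↔ Transc[S, y] := fun y => by
    rw [transcendentalPart_eq_transcendentalSubspace hb, mem_transcendentalSubspace_iff_forall_algebraicClasses hX]
  have hmem' : ∀ y : complexBetti S' (2 * 1), y ∈ transcendentalPart S' b' ↔ Transc[S', y] := fun y => by
    rw [transcendentalPart_eq_transcendentalSubspace hb', mem_transcendentalSubspace_iff_forall_algebraicClasses hX']
  -- intersection forms through the Fujiki forms
  obtain ⟨κ, hκ, hκb⟩ := exists_traceC_cupProduct_eq_of_isFujikiForm hX hb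
  obtain ⟨κ', hκ', hκb'⟩ := exists_traceC_cupProduct_eq_of_isFujikiForm hX' hb'
  -- WLOG `ψ` global: `ψ₁ = ψ ∘ Q`
  obtain ⟨Q, hQrat, hQtyp, hQT, hQid⟩ := exists_rational_transcendentalProjector hX hσ hσ0 hline
  set ψ₁ : complexBetti S (2 * 1) →ₗ[ℂ] complexBetti S' (2 * 1) := ψ ∘ₗ Q with hψ₁
  have hψ₁T : ∀ y, Transc[S, y] → ψ₁ y = ψ y := fun y hy => by rw [hψ₁, LinearMap.comp_apply, hQid y hy]
  have h1 : ∀ y, IsRationalClass y → IsRationalClass (ψ₁ y) := fun y hy =>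
    hψrat _ ((hmem _).2 (hQT y)) (hQrat y hy)
  have h2 : ∀ (i j : ℕ) y, IsOfHodgeType 2 S (2 * 1) i j y → IsOfHodgeType 2 S' (2 * 1) i j (ψ₁ y) :=
    fun i j y hy => hψH i j _ ((hmem _).2 (hQT y)) (hQtyp i j y hy)
  have h4 : ∀ y, Transc[S', ψ₁ y] := fun y => (hmem' _).1 (hψbij.mapsTo ((hmem _).2 (hQT y)))
  have hinj : ∀ y, Transc[S, y] → ψ₁ y = 0 → y = 0 := by
    intro y hy h0
    rw [hψ₁T y hy] at h0
    have h00 : ψ (0 : complexBetti S (2 * 1)) = 0 := map_zero ψ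
    exact hψbij.injOn ((hmem _).2 hy) ((hmem _).2 fun d _ => by rw [map_zero, LinearMap.zero_apply])
      (h0.trans h00.symm)
  have hsurj : ∀ y', Transc[S', y'] → ∃ y, Transc[S, y] ∧ ψ₁ y = y' := by
    intro y' hy'
    obtain ⟨y, hy, rfl⟩ := hψbij.surjOn ((hmem' _).2 hy')
    exact ⟨y, (hmem _).1 hy, hψ₁T y ((hmem _).1 hy)⟩
  have hmul : ∀ y w : complexBetti S (2 * 1), Transc[S, y] → Transc[S, w] →
      traceC hX' (cupProduct (rfl : 2 * 1 + 2 * 1 = 2 * 2) (ψ₁ y) (ψ₁ w)) =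
        (κ' * κ⁻¹) * traceC hX (cupProduct (rfl : 2 * 1 + 2 * 1 = 2 * 2) y w) := by
    intro y w hy hw
    rw [hψ₁T y hy, hψ₁T w hw, hκb', hκb, hψiso _ ((hmem _).2 hy) _ ((hmem _).2 hw)]
    field_simp
  obtain ⟨Φ, hΦ, hΦψ⟩ := exists_algebraicCorrespondence_eq_of_similitude_of_kugaSatake₂ hX hX' hσ hσ0 hline
    hσ' hσ'0 hline' hKS hKS' ψ₁ h1 h2 h4 hinj hsurj (mul_ne_zero hκ' (inv_ne_zero hκ)) hmul
  refine ⟨Φ, hΦ, fun x hx => ?_⟩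
  rw [hΦψ x ((hmem x).1 hx), hψ₁T x ((hmem x).1 hx)]

end Summit.HodgeConjecture.HodgeConjecture.Theorems.MarkmanPartnerTransport.KugaSatakePair

end
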